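import Literature.NumberTheory.GaloisCohomology.Howard2004.DVRSettingEngineH159Proofs
import Literature.NumberTheory.GaloisCohomology.Howard2004.ResidualTateDualBijectiveProofs
import Literature.NumberTheory.GaloisCohomology.Howard2004.ResidualSelfOrthogonalProofs
import Literature.NumberTheory.GaloisCohomology.Howard2004.ResidualSelmerEigenpartsProofs
import HarnessLib

/-!
# Howard 2004, Lemma 1.5.6 / Thm. 1.1.11 for the RESIDUAL representation on a `DVRSetting`: the Lagrangian count
# `#loc_ℓ H¹_{F̄^ℓ(n)}(K, T̄) · #loc_ℓ H¹_{F̄^ℓ(n)}(K, T̄) = #H¹(K_ℓ, T̄)` (the letter `hcard` of the (GD-line) assembly)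

Topic `NumberTheory/GaloisCohomology/Howard2004` (sequel to `FrobeniusReadoutLagrangianCountProofs`
(`DualityDatum.natCard_map_localization_selmerGroup_mul_self_frob`: the count for ANY `R`-linear `T` in Frobenius-reading
form, seat x9-p1-w4), `ResidualTateDualBijectiveProofs` (R1: `Θ̄` bijective, residual `hdet`), `ResidualSelfOrthogonalProofs`
(R2: H.4 for the residual structure), `DVRSettingEngineH159Proofs` (the level-`k` template `engine_h159`) and
`ResidualSelmerEigenpartsProofs` (`R_k`-stability, `H¹(K_∞, T̄) = 0`)).  THEOREMS ONLY: no definition, no named fact, no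
instance, no notation, no `sorry`.

B. Howard, *The Heegner point Kolyvagin system*, Compositio Math. 140 (2004) = arXiv:1202.6340, Lemma 1.5.6 (p. 10
L80–97, «`loc_ℓ H¹_{F^ℓ(n)}(K, T)` is maximal isotropic … `len(A) = len(A^⟂)`») as used in the proof of Lemma 1.5.3 for
`T̄` (p. 10 L27–40) through Thm. 1.1.11 (global duality).  This file is brick R4 (RES-CARD) of the cell's (GD-line) split
(x10b-p1-w8 g11 08:03Z / LEAD g12 08:05Z): the letter
`hcard : ∀ ℓ ∈ 𝓛^{(2k-1)}, ℓ ∉ n → #A · #A = #H¹(K_ℓ, T̄)`, `A = loc_ℓ Sel_{F̄_k^ℓ(n)}`, for ANY residual duality datum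
`D̄` compatible with H.4 (`hDbar`, `exists_residualDualityDatum`), on a `DVRSetting` with H.0–H.5, `d_K < -4` and the
Poitou–Tate fact `poitouTate_selmerStructure_duality K` (binders, as in `engine_h159`).

* `residual_pow_e_smul_eq_zero`, `residual_succ_residueChar_smul_eq_zero` (`p^{e_k} · T̄ = 0`, `(ℓ+1) · T̄ = 0`),
  `isUnramifiedAt_rhobar_of_not_mem_Sigma`, `residualStructure_inr_eq_unramifiedSubgroup` (`F̄_k(v) = H¹_ur` off `Σ(F)`);
* `isSelfOrthogonal_residualStructure_atLevel` — H.4 for `F̄_k(n)` at EVERY finite place (R2 off `n`; on `n` the transverse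
  self-orthogonality `isSelfOrthogonalAt_of_transverse` at `T̄`, with `hφ` discharged by
  `ConjugationDatum.φ_mem_localRingClassSubgroup`);
* **`residual_hcard`** — the letter `hcard`.

Cell `pub/bsd-print-x9`, G87 = Howard Thm. 1.6.1 (print leaf `stub_h161` of stmt-BirchSwinnertonDyer-22642); seat
`bsd-line-x10b-p1-w6` g9, brick R4 (RES-CARD).  `thm161_dvrKolyvaginBound` is NOT proved; BSD is not proved by any of this.

References: [Howard2004HeegnerKolyvagin] Thm. 1.1.11, Lemma 1.5.6, H.4; [MilneADT2006] I Cor. 2.3, I Thm. 4.10.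
-/

set_option autoImplicit false

noncomputable section

open Function NumberField IsDedekindDomain Field CategoryTheory
open scoped NumberField ContRepresentation Classical

namespace Literature.NumberTheory.GaloisCohomology.Howard2004

open Literature.NumberTheory.GaloisRepresentations
open Literature.NumberTheory.GaloisRepresentations.DiscreteGaloisModule
open Literature.NumberTheory.EllipticCurves

namespace DVRSetting

variable {p : ℕ} [Fact p.Prime] {K : Type} [Field K] [NumberField K]
  {R : Type} [CommRing R] [IsDomain R] [IsDiscreteValuationRing R] [Algebra ℤ_[p] R]
  {N : ℕ → Type} [∀ k, AddCommGroup (N k)] [∀ k, TopologicalSpace (N k)]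
  [∀ k, DiscreteTopology (N k)] [∀ k, Module R (N k)]
  {Rk : ℕ → Type} [∀ k, CommRing (Rk k)] [∀ k, IsLocalRing (Rk k)] [∀ k, TopologicalSpace (Rk k)]
  [∀ k, DiscreteTopology (Rk k)] [∀ k, Algebra ℤ_[p] (Rk k)] [∀ k, Algebra R (Rk k)]
  [∀ k, Module (Rk k) (N k)] [∀ k, IsScalarTower R (Rk k) (N k)]
  {Nbar : Type} [AddCommGroup Nbar] [TopologicalSpace Nbar] [DiscreteTopology Nbar]
  [∀ k, Module (Rk k) Nbar]
  {Nq : ℕ → Finset (HeightOneSpectrum (𝓞 K)) → Type} [∀ k n, AddCommGroup (Nq k n)]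
  [∀ k n, TopologicalSpace (Nq k n)] [∀ k n, DiscreteTopology (Nq k n)]
  [∀ k n, Module (Rk k) (Nq k n)] [∀ k n, Module R (Nq k n)]
  [∀ k n, IsScalarTower R (Rk k) (Nq k n)]

/-! ## §1 Local letters for `T̄` -/

/-- `p^{e_k} · T̄ = 0` (indeed `p · T̄ = 0`). [cite: Howard2004HeegnerKolyvagin, H.1 (arXiv p. 7 L59)] -/
theorem residual_pow_e_smul_eq_zero (S : DVRSetting p K R N Rk Nbar Nq) (hy : S.SatisfiesH) (k : ℕ) (x : Nbar) :
    p ^ S.e k • x = 0 := by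
  have hek : 0 < S.e k := hy.e_zero.trans_le (hy.e_strictMono.monotone (Nat.zero_le k))
  obtain ⟨e, he⟩ := Nat.exists_eq_succ_of_ne_zero hek.ne'
  rw [he, pow_succ, mul_smul, S.p_nsmul_residual_eq_zero hy x, smul_zero]

/-- `(ℓ + 1) · T̄ = 0` at `ℓ ∈ 𝓛^{(2k-1)}` (`p^{2e_k-1} ∣ ℓ+1` in `R` and `𝔪^{e_k} T^{(k)} = 0`, read through `π̄_k`).
[cite: Howard2004HeegnerKolyvagin, Def. 1.2.1 and §1.6 (arXiv p. 6 L63–68, p. 11 L33–38)] -/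
theorem residual_succ_residueChar_smul_eq_zero (S : DVRSetting p K R N Rk Nbar Nq) (hy : S.SatisfiesH) (k : ℕ)
    {v : HeightOneSpectrum (𝓞 K)} (hv : v ∈ S.enginePrimes k) (x : Nbar) : (residueChar v + 1) • x = 0 := by
  obtain ⟨m, rfl⟩ := (hy.h1 k).1.surjective x
  obtain ⟨a, ha⟩ := Ideal.mem_span_singleton'.mp hv.2.2.1
  have hs : ((p : ℕ) : R) ^ (2 * S.e k - 1) ∈ IsLocalRing.maximalIdeal R ^ S.e k :=
    S.natCast_pow_mem_maximalIdeal_pow_of_le hy (by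
      have := hy.e_zero.trans_le (hy.e_strictMono.monotone (Nat.zero_le k)); omega)
  rw [← map_nsmul, ← Nat.cast_smul_eq_nsmul R, ← ha, mul_smul, hy.killed k _ hs m, smul_zero, map_zero]

/-- `T̄` is unramified off `Σ(F)` (a quotient of the unramified `T^{(k)}`).
[cite: Howard2004HeegnerKolyvagin, Def. 1.1.10 and §1.2 (arXiv p. 6 L10–24, L54–56)] -/
theorem isUnramifiedAt_rhobar_of_not_mem_Sigma (S : DVRSetting p K R N Rk Nbar Nq) (hy : S.SatisfiesH) (k : ℕ)
    {v : HeightOneSpectrum (𝓞 K)} (hv : (Sum.inr v : Place K) ∉ (S.t k).Sigma) :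
    GaloisRep.IsUnramifiedAt v S.ρbar :=
  (hy.h1 k).1.isUnramifiedAt (S.not_mem_and_isUnramifiedAt_of_not_mem_Sigma k (S.e k) v hv).2

/-- **`F̄_k(v) = H¹_ur(K_v, T̄)` off `Σ(F)`** (the propagated structure of an unramified condition is unramified).
[cite: Howard2004HeegnerKolyvagin, Def. 1.1.3 and Def. 1.1.10 (arXiv p. 5 L93–99, p. 6 L10–24)] [cite: MazurRubinMemoirs2004, Lemma 1.1.5] -/
theorem residualStructure_inr_eq_unramifiedSubgroup [∀ k, Finite (N k)] (S : DVRSetting p K R N Rk Nbar Nq)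
    (hy : S.SatisfiesH) (k : ℕ) {v : HeightOneSpectrum (𝓞 K)} (hv : (Sum.inr v : Place K) ∉ (S.t k).Sigma) :
    ((hy.h1 k).1.propagateStructure (S.t k).cond) (Sum.inr v) = unramifiedSubgroup (GaloisRep.toLocal v S.ρbar) 1 :=
  (hy.h1 k).1.propagateStructure_inr_eq_unramifiedSubgroup (S.t k).cond
    ((S.t k).isHoward.isUnramifiedOutside.2 v hv) (S.not_mem_and_isUnramifiedAt_of_not_mem_Sigma k (S.e k) v hv).2

/-! ## §2 H.4 for `F̄_k(n)` at every finite place -/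

/-- **H.4 for the residual level structure `F̄_k(n)`** (`n ⊆ 𝓛^{(2k-1)}`, `d_K < -4`): off `n` from H.4 for `F̄_k` (R2), at the
transverse primes of `n` from the count `#H¹_tr · #H¹_tr = #H¹(K_λ, T̄)` and the isotropy of the transverse classes
(`isSelfOrthogonalAt_of_transverse` at `T̄`; the reading `Θ̄` of R1). [cite: Howard2004HeegnerKolyvagin, §1.3 H.4 and Lemma 1.5.6 (arXiv p. 7 L69–82, p. 10 L86–88)] -/
theorem isSelfOrthogonal_residualStructure_atLevel [Finite Nbar] [∀ k, Finite (N k)] (S : DVRSetting p K R N Rk Nbar Nq)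
    (hy : S.SatisfiesH) (k : ℕ) (hd : NumberField.discr K < -4) (hPT : poitouTate_selmerStructure_duality K)
    (Dbar : DualityDatum p S.cd S.ρbar (Rk k))
    (hDbar : ∀ s t : N k, Dbar.e (S.πbar k s) (S.πbar k t) = algebraMap R (Rk k) S.π ^ (S.e k - 1) * (S.D k).e s t)
    {n : Finset (HeightOneSpectrum (𝓞 K))} (hn : ↑n ⊆ S.enginePrimes k) :
    Dbar.IsSelfOrthogonal
      (((hy.h1 k).1.propagateStructure (S.t k).cond).modify (transverseStructure p S.ρbar S.jbar) ∅ ∅ n) := by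
  have hp : p.Prime := Fact.out
  haveI : NeZero (p ^ S.e k) := ⟨pow_ne_zero _ hp.ne_zero⟩
  have hdeg : ∀ v ∈ S.enginePrimes k, IsDegreeTwo v := fun v hv => ((Set.mem_iInter.1 hv.2.1) k).1
  have hpe : ((p : ℕ) : R) ^ S.e k ∈ IsLocalRing.maximalIdeal R ^ S.e k :=
    S.natCast_pow_mem_maximalIdeal_pow_of_le hy le_rfl
  have hRk : ∀ r : Rk k, p ^ S.e k • r = 0 := S.natCast_pow_smul_levelRing_eq_zero hy k hpe
  have hNbar : ∀ m : Nbar, p ^ S.e k • m = 0 := S.residual_pow_e_smul_eq_zero hy k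
  have hNbar' : ∀ x : Nbar, ∃ m : ℕ, p ^ m • x = 0 := fun x => ⟨S.e k, hNbar x⟩
  have hodd : Odd (p ^ S.e k) := (hp.odd_of_ne_two hy.p_odd).pow
  -- the trivialisation `exp = log⁻¹` of `μ_{p^{e_k}}`
  have hpK : (p : K) ≠ 0 := Nat.cast_ne_zero.mpr hp.ne_zero
  obtain ⟨log, hlogbij, hlogχ, -⟩ := exists_compatible_muLog K p hpK
  let Lg : MuCarrier K (p ^ S.e k) ≃+ ZMod (p ^ S.e k) := AddEquiv.ofBijective (log (S.e k)) (hlogbij (S.e k))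
  let exp : ZMod (p ^ S.e k) →+ MuCarrier K (p ^ S.e k) := Lg.symm
  have hexpb : Bijective exp := Lg.symm.bijective
  have hexp : ∀ (g : absoluteGaloisGroup K) (x : ZMod (p ^ S.e k)),
      exp (cyclotomicCharacterModPow K p (S.e k) g * x) = mu K (p ^ S.e k) g (exp x) := fun g x => by
    apply Lg.injective
    change Lg (Lg.symm _) = log (S.e k) (mu K _ g (Lg.symm x))
    rw [AddEquiv.apply_symm_apply, hlogχ, show log (S.e k) (Lg.symm x) = Lg (Lg.symm x) from rfl,
      AddEquiv.apply_symm_apply]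
  -- the residual reading `Θ̄` (R1)
  obtain ⟨lam, hlam, -, hΘ⟩ := S.exists_residual_toTateDual_bijective hy k hpe exp hexp hexpb Dbar
  obtain ⟨inv, hperf, -, -, -⟩ := hPT (p ^ S.e k)
  have hn_fix : ∀ v ∈ n, S.cd.σ • v = v := fun v hv => S.sigma_smul_eq_self_of_mem_L hy (hn hv).1
  have hnlev : (↑n : Set (HeightOneSpectrum (𝓞 K))) ⊆ S.levelPrimes k :=
    hn.trans (S.enginePrimes_subset_levelPrimes hy k)
  have htrivAt : ∀ v ∈ n, ∀ (g : absoluteGaloisGroup (v.adicCompletion K)) (x : Nbar),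
      GaloisRep.toLocal v S.ρbar g x = x := fun v hv g x =>
    S.toLocal_ρbar_apply_eq_self_of_subset_levelPrimes hy hnlev hv g x
  have htrivAt' : ∀ v ∈ n, ∀ (g : absoluteGaloisGroup ((S.cd.σ • v).adicCompletion K)) (x : Nbar),
      GaloisRep.toLocal (S.cd.σ • v) S.ρbar g x = x := fun v hv g x =>
    S.toLocal_ρbar_apply_eq_self_of_subset_levelPrimes hy hnlev (by rw [hn_fix v hv]; exact hv) g x
  have htrivTwAt : ∀ v ∈ n, ∀ (g : absoluteGaloisGroup (v.adicCompletion K)) (x : Nbar),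
      GaloisRep.toLocal v (S.cd.twist S.ρbar) g x = x := fun v hv =>
    S.cd.toLocal_twist_apply_eq_self S.ρbar v (htrivAt' v hv)
  refine Dbar.isSelfOrthogonal_of_eq_off ((hy.h1 k).1.propagateStructure (S.t k).cond) _
    (↑n : Set (HeightOneSpectrum (𝓞 K))) (fun v hv => ?_) (fun v hv => ?_)
    (S.isSelfOrthogonal_residualStructure hy k Dbar hDbar) (fun v hv => ?_)
  · rw [Finset.mem_coe] at hv ⊢
    rw [hn_fix v hv]; exact hv
  · rw [Finset.mem_coe] at hv
    exact SelmerStructure.modify_inr_of_not_mem _ _ (Finset.notMem_empty _) (Finset.notMem_empty _) hv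
  · rw [Finset.mem_coe] at hv
    have hfix : S.cd.σ • v = v := hn_fix v hv
    have h𝓖v : ((hy.h1 k).1.propagateStructure (S.t k).cond).modify (transverseStructure p S.ρbar S.jbar) ∅ ∅ n
        (Sum.inr v) = transverseStructure p S.ρbar S.jbar (Sum.inr v) :=
      SelmerStructure.modify_inr_of_mem_transverse _ _ (Finset.notMem_empty _) (Finset.notMem_empty _) hv
    obtain ⟨σ₀, -, hcyc⟩ :=
      exists_forall_pow_inv_mul_mem_localRingClassSubgroup_of_isDegreeTwo hy.imagQuad hd S.jbar (hdeg v (hn hv))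
    refine Dbar.isSelfOrthogonalAt_of_transverse lam hlam exp hexp hNbar hΘ inv hperf (residueChar v) S.jbar v _
      (by rw [h𝓖v, transverseStructure_inr]; rfl) (by rw [hfix, h𝓖v, transverseStructure_inr]; rfl)
      (htrivAt v hv) (htrivAt' v hv) (htrivTwAt v hv) hNbar' hodd hRk σ₀ hcyc
      (fun h hh => S.cd.φ_mem_localRingClassSubgroup hy.imagQuad S.jbar (prime_residueChar v).ne_zero v hh) ?_
    rw [hfix, h𝓖v]
    exact natCard_transverseStructure_mul_eq_of_isDegreeTwo p hy.imagQuad hd S.ρbar S.jbar (hdeg v (hn hv)) rfl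
      (htrivAt v hv) (htrivAt v hv) hNbar' (S.residual_succ_residueChar_smul_eq_zero hy k (hn hv))

/-! ## §3 The letter `hcard` -/

/-- **Howard's Lemma 1.5.6 count for `T̄`: `#A · #A = #H¹(K_ℓ, T̄)`, `A = loc_ℓ H¹_{F̄_k^ℓ(n)}(K, T̄)`**, at every
`ℓ ∈ 𝓛^{(2k-1)} ∖ n` (`n ⊆ 𝓛^{(2k-1)}`), for ANY residual duality datum `D̄` compatible with H.4 — the letter `hcard` of the
(GD-line) assembly (`DVRSettingEngineGDLineProofs.engine_gd_dich_of_letters`, seat x10b-p1-w8 g11).  Proof: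
`natCard_map_localization_selmerGroup_mul_self_frob` at (`S.ρbar`, `D̄`, `𝓡 = F̄_k^ℓ(n)`, `𝓕 = F̄_k(n)`,
`S = Σ(F^ℓ(n))`) with `Θ̄`/`hdet` from R1, H.4 from §2, unramifiedness of `F̄_k` off `Σ(F)` from §1, `R_k`-stability
(`ResidualSelmerEigenpartsProofs`), `H¹(K_∞, T̄) = 0`, and the Poitou–Tate fact.
[cite: Howard2004HeegnerKolyvagin, Lemma 1.5.6 and Thm. 1.1.11 (arXiv:1202.6340 p. 10 L80–97, p. 6 L34–45)] [cite: MilneADT2006, Ch. I Cor. 2.3 and Thm. 4.10] -/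
theorem residual_hcard [Finite Nbar] [∀ k, Finite (N k)] (S : DVRSetting p K R N Rk Nbar Nq) (hy : S.SatisfiesH) (k : ℕ)
    (hd : NumberField.discr K < -4) (hPT : poitouTate_selmerStructure_duality K)
    (Dbar : DualityDatum p S.cd S.ρbar (Rk k))
    (hDbar : ∀ s t : N k, Dbar.e (S.πbar k s) (S.πbar k t) = algebraMap R (Rk k) S.π ^ (S.e k - 1) * (S.D k).e s t)
    {n : Finset (HeightOneSpectrum (𝓞 K))} (hn : ↑n ⊆ S.enginePrimes k) :
    ∀ v ∈ S.enginePrimes k, v ∉ n →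
      Nat.card ((((hy.h1 k).1.propagateStructure (S.t k).cond).modify (transverseStructure p S.ρbar S.jbar)
          {v} ∅ n).selmerGroup.map (galoisCohomology.localization S.ρbar (Sum.inr v) 1)) *
        Nat.card ((((hy.h1 k).1.propagateStructure (S.t k).cond).modify (transverseStructure p S.ρbar S.jbar)
          {v} ∅ n).selmerGroup.map (galoisCohomology.localization S.ρbar (Sum.inr v) 1)) =
      Nat.card (galoisCohomology (S.ρbar.toLocal (Sum.inr v)) 1) := by
  intro q hq hqn
  have hp : p.Prime := Fact.out
  haveI : NeZero (p ^ S.e k) := ⟨pow_ne_zero _ hp.ne_zero⟩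
  have hpe : ((p : ℕ) : R) ^ S.e k ∈ IsLocalRing.maximalIdeal R ^ S.e k :=
    S.natCast_pow_mem_maximalIdeal_pow_of_le hy le_rfl
  have hRk : ∀ r : Rk k, p ^ S.e k • r = 0 := S.natCast_pow_smul_levelRing_eq_zero hy k hpe
  have hNbar : ∀ m : Nbar, p ^ S.e k • m = 0 := S.residual_pow_e_smul_eq_zero hy k
  have hqfix : S.cd.σ • q = q := S.sigma_smul_eq_self_of_mem_L hy hq.1
  -- the trivialisation `exp = log⁻¹` of `μ_{p^{e_k}}`
  have hpK : (p : K) ≠ 0 := Nat.cast_ne_zero.mpr hp.ne_zero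
  obtain ⟨log, hlogbij, hlogχ, -⟩ := exists_compatible_muLog K p hpK
  let Lg : MuCarrier K (p ^ S.e k) ≃+ ZMod (p ^ S.e k) := AddEquiv.ofBijective (log (S.e k)) (hlogbij (S.e k))
  let exp : ZMod (p ^ S.e k) →+ MuCarrier K (p ^ S.e k) := Lg.symm
  have hexpb : Bijective exp := Lg.symm.bijective
  have hexp : ∀ (g : absoluteGaloisGroup K) (x : ZMod (p ^ S.e k)),
      exp (cyclotomicCharacterModPow K p (S.e k) g * x) = mu K (p ^ S.e k) g (exp x) := fun g x => by
    apply Lg.injective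
    change Lg (Lg.symm _) = log (S.e k) (mu K _ g (Lg.symm x))
    rw [AddEquiv.apply_symm_apply, hlogχ, show log (S.e k) (Lg.symm x) = Lg (Lg.symm x) from rfl,
      AddEquiv.apply_symm_apply]
  -- the residual reading `Θ̄` and its `H²`-detection (R1)
  obtain ⟨lam, hlam, hfrob, hΘ⟩ := S.exists_residual_toTateDual_bijective hy k hpe exp hexp hexpb Dbar
  have hdet := S.residual_hdet hy k hpe exp hexp hexpb Dbar lam hlam hfrob
  obtain ⟨inv, hperf, hPT0, -, hSC⟩ := hPT (p ^ S.e k)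
  -- the places: `S = Σ(F^q(n))`
  have hS : ∀ v : HeightOneSpectrum (𝓞 K), (Sum.inr v : Place K) ∉ ((S.t k).modify S.jbar {q} ∅ n).Sigma →
      ((p ^ S.e k : ℕ) : 𝓞 K) ∉ v.asIdeal ∧ GaloisRep.IsUnramifiedAt v S.ρbar := fun v hv =>
    ⟨(S.not_mem_and_isUnramifiedAt_of_not_mem_Sigma k (S.e k) v (fun h => hv (Finset.mem_union_left _ h))).1,
      S.isUnramifiedAt_rhobar_of_not_mem_Sigma hy k (fun h => hv (Finset.mem_union_left _ h))⟩
  have hqS : (Sum.inr q : Place K) ∈ ((S.t k).modify S.jbar {q} ∅ n).Sigma := by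
    change _ ∈ (S.t k).Sigma ∪ _
    simp
  have h𝓡S : (((hy.h1 k).1.propagateStructure (S.t k).cond).modify (transverseStructure p S.ρbar S.jbar)
      {q} ∅ n).IsUnramifiedOutside ((S.t k).modify S.jbar {q} ∅ n).Sigma := by
    refine ⟨fun w => Finset.mem_union_left _ ((S.t k).isHoward.isUnramifiedOutside.1 w), fun v hv => ?_⟩
    have hvSig : (Sum.inr v : Place K) ∉ (S.t k).Sigma := fun h => hv (Finset.mem_union_left _ h)
    have hvqn : v ∉ ({q} ∪ ∅ ∪ n : Finset (HeightOneSpectrum (𝓞 K))) := fun h =>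
      hv (Finset.mem_union_right _ (Finset.mem_image_of_mem _ h))
    simp only [Finset.union_empty, Finset.mem_union, Finset.mem_singleton, not_or] at hvqn
    rw [SelmerStructure.modify_inr_of_not_mem _ _ (by simpa using hvqn.1) (Finset.notMem_empty _) hvqn.2]
    exact S.residualStructure_inr_eq_unramifiedSubgroup hy k hvSig
  have hrel : (((hy.h1 k).1.propagateStructure (S.t k).cond).modify (transverseStructure p S.ρbar S.jbar)
      {q} ∅ n) (Sum.inr q) = ⊤ :=
    SelmerStructure.modify_inr_of_mem_relaxed _ _ (Finset.mem_singleton_self q)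
  have hoff : ∀ v : HeightOneSpectrum (𝓞 K), v ≠ q →
      (((hy.h1 k).1.propagateStructure (S.t k).cond).modify (transverseStructure p S.ρbar S.jbar) {q} ∅ n)
        (Sum.inr v) =
      (((hy.h1 k).1.propagateStructure (S.t k).cond).modify (transverseStructure p S.ρbar S.jbar) ∅ ∅ n)
        (Sum.inr v) := fun v hv =>
    (SelmerStructure.modify_level_eq_relaxed_of_ne ((hy.h1 k).1.propagateStructure (S.t k).cond)
      (transverseStructure p S.ρbar S.jbar) q n (Sum.inr v) (fun h => hv (Sum.inr_injective h))).symm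
  -- H.4 for `F̄_k(n)` (§2), `R_k`-stability, `H¹(K_∞, T̄) = 0`
  have horth := S.isSelfOrthogonal_residualStructure_atLevel hy k hd hPT Dbar hDbar hn
  have hρ : S.ρbar.IsScalarLinear (Rk k) := S.isScalarLinear_rhobar hy k
  have hstab : ∀ v : HeightOneSpectrum (𝓞 K), v ≠ q → ∀ b : Rk k,
      ∀ a ∈ (((hy.h1 k).1.propagateStructure (S.t k).cond).modify (transverseStructure p S.ρbar S.jbar) ∅ ∅ n)
        (Sum.inr v),
      galoisCohomology.scalarMapH1 (S.ρbar.toLocal (Sum.inr v)) (DualityDatum.isScalarLinear_toLocal hρ (Sum.inr v))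
        b a ∈
        (((hy.h1 k).1.propagateStructure (S.t k).cond).modify (transverseStructure p S.ρbar S.jbar) ∅ ∅ n)
          (Sum.inr v) :=
    fun v _ b a ha => (S.isScalarStable_residualStructure_modify hy k ∅ ∅ n) (Sum.inr v) b ha
  have hinf : ∀ (w : InfinitePlace K) (c : galoisCohomology S.ρbar 1),
      galoisCohomology.localization S.ρbar (Sum.inl w) 1 c = 0 := fun w c =>
    S.galoisCohomology_rhobar_toLocal_inl_eq_zero hy w _
  exact Dbar.natCard_map_localization_selmerGroup_mul_self_frob lam hlam exp hexp hNbar hρ inv hPT0 hSC hperf hΘ hdet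
    ((S.t k).modify S.jbar {q} ∅ n).Sigma hS _ _ hqfix hqS h𝓡S hrel hoff (fun v _ => horth v) hstab hinf

end DVRSetting

end Literature.NumberTheory.GaloisCohomology.Howard2004

end
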